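import Summits.ABC.IUTFork.ForkAbc
import Summits.ABC.IUTFork.Thm311Regions
import Summits.ABC.IUTFork.Cor312EdgeRegions

/-!
# Kernel DAG index — APEX IN THE AUTHOR'S TERMS: `ABC` from Theorem 3.11's typed situation + the (xi-f) licence (spec §4 (3))

index v1 · abc-iut-c312-2 (filer) per HOME/plan/KERNEL-DAG-SPEC.md v1.3 §4 rule (3) ("as M lands Thm 3.11 / the step chain,
`h312` is replaced by `(hThm311 …) (hSteps …)` through the §3 edges"). Companion of `DAGTop.lean` (`summit_of_cor312`,
kernel_hyps = 2) and `DAGTopReadings.lean` (apex per reading over the skeleton's containers).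

THIS FILE PROVES NOTHING NEW AND ASSERTS NOTHING. It composes, BY NAME, four landed pieces: skel V
`abc_of_indeterminacies_of_cor312` (ForkAbc), c312-1's typed situation of [IUTchIII] Theorem 3.11 with Cor. 3.12's
nouns in the author's indexing (`Thm311.LatticeSituation`, `Thm311.PilotNouns`: possible images per component
`(j, v_ℚ)`, holomorphic hull, `q`-pilot region, the procession-normalized aggregate `−|log(Θ)|`, `−|log(q)|`,
`Cor312At`; files A–C, G) and its bridge H (`PilotNouns.toCor312Setting`, `cor312At_of_componentwise`), and skel
XVII (`Cor312Setting.cor312_of_qSubHull`, Reading 2 of the (xi-f) edge; c312-2 V-b `Cor312EdgeRegions`).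

`summit_of_cor312_M`: `ABC` from — the family `V`, its Thm-1.10 data `T`, the abc dictionary `A`; the multiradial
estimate per curve (`hInd`); per curve a typed lattice situation `S P` of Theorem 3.11 with pilot nouns `Pn P` at a
lattice position `(n, m)`; componentwise admissibility (`hadm`, the data skel XVII asks of a container); the two
finiteness clauses of Cor. 3.12's statement (`hreal` "−|log(Θ)| ∈ ℝ", `hqreal`); THE LICENCE `hLic` — in every
component `(j, v_ℚ)` the `q`-pilot region lies in the holomorphic hull of the possible images of the Θ-pilot
region (Reading 2 of Step (xi-f); the author's claim [claim: Mochizuki2012, status: disputed] is that Theorem 3.11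
(i)–(iii) — c312-1 `FullSituation.Statement`, file D, pending — yields it; Scholze–Stix and LANA read the same
place differently, `DAGTopReadings.no_apex_SS`, `summit_of_cor312_LANA`); and the identification of the author's
aggregate numbers with the curve's Thm-1.10 numbers (`hΘ`, `hq`: [IUTchIV] Thm 1.10 "the quantity `|log(q)|` …
is equal to `(1/2l)·log(q)`"). kernel_hyps = 7 (hInd, hadm, hreal, hqreal, hLic, hΘ, hq) + inputs V, T, A, S, Pn,
n, m — MORE than `DAGTop`'s 2, honestly: `h312` has been unbundled into its typed constituents, of which exactly
ONE (`hLic`) is the disputed content and the rest are data/admissibility/identifications.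

HONEST FRAMING: nothing here asserts that abc is proved or refuted or takes a side on Cor. 3.12; the theorem says
"abc follows from exactly these named inputs". typed ≠ discharged; indexed ≠ endorsed.
-/

noncomputable section

namespace Summit.ABC.IUTFork.DAG

open Cor312Proof Thm311

/-- **APEX in the author's terms.** See the module docstring for the reading of each hypothesis. Route, by
name: `hLic` ⟹ skel `Cor312Setting.cor312_of_qSubHull` in every component ⟹ c312-1 H
`PilotNouns.cor312At_of_componentwise` ⟹ the author's aggregate `Cor312At n m` ⟹ (`hΘ`, `hq`) the curve's
`Thm110Data.Cor312` ⟹ skel `abc_of_indeterminacies_of_cor312`. [claim: Mochizuki2012, status: disputed] -/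
theorem summit_of_cor312_M (V : HeightFamily) (T : Thm110Family V) (A : AbcDictionary V)
    (hInd : MochizukiIndeterminacies T) {TI : V.Pt → ThetaIndex} (S : ∀ P, LatticeSituation (TI P))
    (Pn : ∀ P, PilotNouns (S P)) (n m : ℤ)
    (hadm : ∀ P (j : (TI P).LabelStar) (vQ : (TI P).VQ), (Pn P).ComponentAdm n m j vQ)
    (hreal : ∀ P, (Pn P).NegLogThetaReal n m) (hqreal : ∀ P, (Pn P).NegLogQReal n m)
    (hLic : ∀ P (j : (TI P).LabelStar) (vQ : (TI P).VQ), ((Pn P).toCor312Setting n m j vQ (hadm P j vQ)).QSubHull)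
    (hΘ : ∀ P, (Pn P).negLogTheta n m = (T.X P).negLogTheta) (hq : ∀ P, (Pn P).negLogQ n m = -(T.X P).absLogq) :
    _root_.ABC :=
  abc_of_indeterminacies_of_cor312 V T A hInd fun P => by
    have hc : (Pn P).Cor312At n m :=
      (Pn P).cor312At_of_componentwise n m (hadm P) (hreal P) (hqreal P)
        fun j vQ => Cor312Setting.cor312_of_qSubHull _ (hLic P j vQ)
    unfold Thm110Data.Cor312
    rw [← hΘ, ← hq]
    exact hc.2.2

/-- The same with Reading 1 (`RepresentedVol`: the `q`-pilot log-volume is one of the possible values, LANA §8.3's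
paraphrase of Step (xi)) as the licence. [claim: Mochizuki2012, status: disputed] -/
theorem summit_of_cor312_M_represented (V : HeightFamily) (T : Thm110Family V) (A : AbcDictionary V)
    (hInd : MochizukiIndeterminacies T) {TI : V.Pt → ThetaIndex} (S : ∀ P, LatticeSituation (TI P))
    (Pn : ∀ P, PilotNouns (S P)) (n m : ℤ)
    (hadm : ∀ P (j : (TI P).LabelStar) (vQ : (TI P).VQ), (Pn P).ComponentAdm n m j vQ)
    (hreal : ∀ P, (Pn P).NegLogThetaReal n m) (hqreal : ∀ P, (Pn P).NegLogQReal n m)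
    (hLic : ∀ P (j : (TI P).LabelStar) (vQ : (TI P).VQ),
      ((Pn P).toCor312Setting n m j vQ (hadm P j vQ)).RepresentedVol)
    (hΘ : ∀ P, (Pn P).negLogTheta n m = (T.X P).negLogTheta) (hq : ∀ P, (Pn P).negLogQ n m = -(T.X P).absLogq) :
    _root_.ABC :=
  abc_of_indeterminacies_of_cor312 V T A hInd fun P => by
    have hc : (Pn P).Cor312At n m :=
      (Pn P).cor312At_of_componentwise n m (hadm P) (hreal P) (hqreal P)
        fun j vQ => Cor312Setting.cor312_of_representedVol _ (hLic P j vQ)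
    unfold Thm110Data.Cor312
    rw [← hΘ, ← hq]
    exact hc.2.2

/-- … and through the CHAIN: per curve and component, the loci granted, the twenty inferences granted, and the
(xi-f) sentence read as Reading 1 (V-b `setting_cor312_of_chain`). kernel_hyps = 9. [claim: Mochizuki2012, status: disputed] -/
theorem summit_of_cor312_M_chain (V : HeightFamily) (T : Thm110Family V) (A : AbcDictionary V)
    (hInd : MochizukiIndeterminacies T) {TI : V.Pt → ThetaIndex} (S : ∀ P, LatticeSituation (TI P))
    (Pn : ∀ P, PilotNouns (S P)) (n m : ℤ)
    (hadm : ∀ P (j : (TI P).LabelStar) (vQ : (TI P).VQ), (Pn P).ComponentAdm n m j vQ)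
    (hreal : ∀ P, (Pn P).NegLogThetaReal n m) (hqreal : ∀ P, (Pn P).NegLogQReal n m)
    {L : Locus → Prop} {O : Obs → Prop} (hL : ∀ c, L c) (hC : Chain L O)
    (hread : ∀ P (j : (TI P).LabelStar) (vQ : (TI P).VQ), O .constitutesConstruction →
      ((Pn P).toCor312Setting n m j vQ (hadm P j vQ)).RepresentedVol)
    (hΘ : ∀ P, (Pn P).negLogTheta n m = (T.X P).negLogTheta) (hq : ∀ P, (Pn P).negLogQ n m = -(T.X P).absLogq) :
    _root_.ABC :=
  abc_of_indeterminacies_of_cor312 V T A hInd fun P => by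
    have hc : (Pn P).Cor312At n m :=
      (Pn P).cor312At_of_componentwise n m (hadm P) (hreal P) (hqreal P)
        fun j vQ => setting_cor312_of_chain _ hL hC (hread P j vQ)
    unfold Thm110Data.Cor312
    rw [← hΘ, ← hq]
    exact hc.2.2

end Summit.ABC.IUTFork.DAG

end
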